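import Literature.InformationTheory.Coding.MacWilliamsIdentity
import Literature.InformationTheory.Coding.DualDistance
import HarnessLib

/-!
# The MacWilliams identity for binary linear codes given as `𝔽₂`-submodules (Krawtchouk form)

MacWilliams–Sloane, *The Theory of Error-Correcting Codes*, Ch. 5 §2 Theorem 1 and eq. (13): for a binary linear
`[n, k]` code `𝒞` with weight distribution `A_0, …, A_n` and dual code `𝒞⊥` with weight distribution `A'_0, …, A'_n`,

  `|𝒞| · A'_j = Σ_{i=0}^{n} A_i K_j(i)`   (`K_j` the binary Krawtchouk polynomial, eq. (13) cleared of `2^{-k}`),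

together with `Σ_i A_i = |𝒞| = 2^k` and `A_0 = 1`.

The tree proves exactly this in `Coding/MacWilliamsIdentity.lean` (`card_mul_weightCount_perpCode_eq`) for codes
presented as `Finset (Fin n → Bool)` closed under coordinatewise XOR (`IsLinearCode`, `perpCode`, `weightCount`, `wt`),
while the quantum-codes library (`Coding/DualDistance.lean`: `dualCode`; `QuantumCodes/CSS.lean`, `ParityCheckDuality.lean`)
speaks `Submodule (ZMod 2) (Fin n → ZMod 2)`, Mathlib's `hammingNorm` and `dotProduct`. This file is the BRIDGE and the
restatement in that vocabulary (known mathematics, no new claim):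

* `boolWord` / `zmodWord` — the bijection `(Fin n → ZMod 2) ≃ (Fin n → Bool)` (`v i ≠ 0`), with `wt (boolWord v) =
  hammingNorm v` and `dotSign (boolWord u) (boolWord v) = 1 ↔ u ⬝ᵥ v = 0`;
* `boolCode A` — the Bool-word image of a submodule `A`; `isLinearCode_boolCode`, `perpCode_boolCode`
  (`= boolCode (dualCode A)`), `card_boolCode` (`= 2 ^ finrank A`);
* `wdist A i = #{v ∈ A : hammingNorm v = i}` — the weight distribution of a submodule; `weightCount_boolCode`,
  `wdist_zero` (`A_0 = 1`), `sum_wdist` (`Σ_{i ≤ n} A_i = 2 ^ finrank A`), `wdist_mono` (a subcode has fewer words of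
  each weight), `wdist_eq_of_forall_mem` (if every weight-`i` word of `B` lies in `A ≤ B` then `A_i = B_i`),
  `wdist_eq_zero_of_forall` (no word of weight `i`);
* **`pow_finrank_mul_wdist_dualCode`** — `2^{dim A} · A'_j = Σ_{i ≤ n} A_i K_j(i)` for `A ≤ 𝔽₂ⁿ` and its `dualCode`.

## References (locators read on the page)

* [MacWilliamsSloane1977] F. J. MacWilliams, N. J. A. Sloane, *The Theory of Error-Correcting Codes*, North-Holland
  1977, Ch. 5 §2 Theorem 1 and eqs. (11)–(13) (p. 127–129; held chunks p0132–p0134 of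
  `book:macwilliamsnd-theory-error-correcting-codes-gx73440325`, as cited by `MacWilliamsIdentity.lean`), Ch. 1 §8
  (the dual code, eq. (42)).

## Mathlib / tree search (2026-08-27)

`lean search 'weightCount|perpCode|IsLinearCode'`: only `Coding/MacWilliamsIdentity.lean`, `KrawtchoukOrthogonality.lean`,
`PerfectCodeWeightRecurrence.lean` (Bool words / `Finset` codes); several files carry PRIVATE `toBoolWord` conversions for
Hamming balls (`GilbertBound`, `GolayCodePerfect`, `HammingCodePerfect`), none a code-level bridge; the quaternary
`QuantumCodes/QuaternaryMacWilliams.lean` (`wtDist`, symplectic weight) is a different identity. Nothing re-proved here: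
the identity is imported, only transported.
-/

namespace Literature.InformationTheory.Coding

open Finset

variable {n : ℕ}

/-! ### Words: `𝔽₂ⁿ` versus `Bool`-words -/

/-- The Bool word of a binary vector (`true` where the entry is nonzero). Plumbing definition (bridge to
`MacWilliamsIdentity.lean`). [cite: MacWilliamsSloane1977, Ch. 5 §2 eq. (1) (weight = number of nonzero coordinates)] -/
def boolWord (v : Fin n → ZMod 2) : Fin n → Bool := fun i => decide (v i ≠ 0)

/-- The binary vector of a Bool word. Plumbing definition (bridge). [cite: MacWilliamsSloane1977, Ch. 5 §2 eq. (1)] -/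
def zmodWord (u : Fin n → Bool) : Fin n → ZMod 2 := fun i => if u i then 1 else 0

/-- An element of `𝔽₂` is `0` or `1`. [folklore] -/
private theorem zmod2_eq_zero_or_one (a : ZMod 2) : a = 0 ∨ a = 1 := by
  fin_cases a
  · exact Or.inl rfl
  · exact Or.inr rfl

/-- `zmodWord (boolWord v) = v`. [cite: MacWilliamsSloane1977, Ch. 5 §2 eq. (1)] -/
@[simp] theorem zmodWord_boolWord (v : Fin n → ZMod 2) : zmodWord (boolWord v) = v := by
  funext i
  rcases zmod2_eq_zero_or_one (v i) with h | h <;> simp [zmodWord, boolWord, h]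

/-- `boolWord (zmodWord u) = u`. [cite: MacWilliamsSloane1977, Ch. 5 §2 eq. (1)] -/
@[simp] theorem boolWord_zmodWord (u : Fin n → Bool) : boolWord (zmodWord u) = u := by
  funext i
  cases h : u i <;> simp [zmodWord, boolWord, h]

/-- `boolWord` is injective. [cite: MacWilliamsSloane1977, Ch. 5 §2 eq. (1)] -/
theorem boolWord_injective : Function.Injective (boolWord (n := n)) := fun u v h => by
  rw [← zmodWord_boolWord u, ← zmodWord_boolWord v, h]

/-- `zmodWord` is injective. [cite: MacWilliamsSloane1977, Ch. 5 §2 eq. (1)] -/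
theorem zmodWord_injective : Function.Injective (zmodWord (n := n)) := fun u v h => by
  rw [← boolWord_zmodWord u, ← boolWord_zmodWord v, h]

/-- **Weights agree**: `wt (boolWord v) = hammingNorm v`. [cite: MacWilliamsSloane1977, Ch. 5 §2 eq. (1)] -/
@[simp] theorem wt_boolWord (v : Fin n → ZMod 2) : wt (boolWord v) = hammingNorm v := by
  simp [wt, boolWord, hammingNorm]

/-- Sums go to XOR: `boolWord (u + v) = (boolWord u) ⊕ (boolWord v)` coordinatewise. [cite: MacWilliamsSloane1977, Ch. 1 §2 (binary linear codes are closed under the coordinatewise sum)] -/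
theorem boolWord_add (u v : Fin n → ZMod 2) : boolWord (u + v) = fun i => boolWord u i != boolWord v i := by
  funext i
  rcases zmod2_eq_zero_or_one (u i) with hu | hu <;> rcases zmod2_eq_zero_or_one (v i) with hv | hv <;>
    simp +decide [boolWord, hu, hv]

/-- `zmodWord` of a coordinatewise XOR is the sum. [cite: MacWilliamsSloane1977, Ch. 1 §2] -/
theorem zmodWord_bne (u v : Fin n → Bool) : zmodWord (fun i => u i != v i) = zmodWord u + zmodWord v := by
  apply boolWord_injective
  rw [boolWord_add, boolWord_zmodWord, boolWord_zmodWord, boolWord_zmodWord]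

/-- `zmodWord` of the zero Bool word is `0`. [cite: MacWilliamsSloane1977, Ch. 1 §2] -/
@[simp] theorem zmodWord_false : zmodWord (fun _ : Fin n => false) = 0 := by
  funext i; simp [zmodWord]

/-- **The characters agree with the dot product**: `(-1)^{u·v} = 1 ↔ u ⬝ᵥ v = 0` over `𝔽₂`.
[cite: MacWilliamsSloane1977, Ch. 1 §8 eqs. (41)–(42) (u·v = Σ uᵢvᵢ; C⊥ = {v : u·v = 0})] -/
theorem dotSign_boolWord_eq_one_iff (u v : Fin n → ZMod 2) : dotSign (boolWord u) (boolWord v) = 1 ↔ u ⬝ᵥ v = 0 := by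
  classical
  -- both sides are governed by the parity of `m = #{i : u i ≠ 0 ∧ v i ≠ 0}`
  set S : Finset (Fin n) := univ.filter fun i => u i ≠ 0 ∧ v i ≠ 0 with hS
  have hsign : dotSign (boolWord u) (boolWord v) = (-1) ^ #S := by
    rw [dotSign_eq_prod]
    have : ∀ i, (if (boolWord u i && boolWord v i) = true then (-1 : ℤ) else 1) =
        if i ∈ S then (-1 : ℤ) else 1 := by
      intro i; simp [boolWord, hS]
    simp_rw [this]
    rw [Finset.prod_ite_mem, Finset.univ_inter, Finset.prod_const]
  have hdot : u ⬝ᵥ v = ((#S : ℕ) : ZMod 2) := by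
    rw [dotProduct, Finset.card_eq_sum_ones, Nat.cast_sum, ← Finset.sum_filter_add_sum_filter_not univ (· ∈ S)]
    have h1 : ∑ i ∈ univ.filter (· ∈ S), u i * v i = ∑ i ∈ S, ((1 : ℕ) : ZMod 2) := by
      rw [show univ.filter (· ∈ S) = S from by ext i; simp]
      refine Finset.sum_congr rfl fun i hi => ?_
      rw [hS, mem_filter] at hi
      rcases zmod2_eq_zero_or_one (u i) with hu | hu
      · exact absurd hu hi.2.1
      rcases zmod2_eq_zero_or_one (v i) with hv | hv
      · exact absurd hv hi.2.2
      rw [hu, hv]; simp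
    have h2 : ∑ i ∈ univ.filter (fun i => ¬ i ∈ S), u i * v i = 0 := by
      refine Finset.sum_eq_zero fun i hi => ?_
      rw [mem_filter, hS, mem_filter] at hi
      simp only [mem_univ, true_and, not_and, not_not] at hi
      rcases zmod2_eq_zero_or_one (u i) with hu | hu
      · rw [hu, zero_mul]
      · rw [hi (by rw [hu]; exact one_ne_zero), mul_zero]
    rw [h1, h2, add_zero]
  rw [hsign, hdot, neg_one_pow_eq_one_iff_even (by norm_num), ZMod.natCast_eq_zero_iff_even]

/-! ### Codes: a submodule as a `Finset` of Bool words -/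

open scoped Classical in
/-- The Bool-word image of a binary linear code `A ≤ 𝔽₂ⁿ` (a `Finset (Fin n → Bool)`, the presentation used by
`MacWilliamsIdentity.lean`). Plumbing definition (bridge). [cite: MacWilliamsSloane1977, Ch. 1 §2 ("[n, k] binary linear code")] -/
noncomputable def boolCode (A : Submodule (ZMod 2) (Fin n → ZMod 2)) : Finset (Fin n → Bool) :=
  univ.filter fun u => zmodWord u ∈ A

open scoped Classical in
/-- Membership in `boolCode`. [cite: MacWilliamsSloane1977, Ch. 1 §2] -/
@[simp] theorem mem_boolCode {A : Submodule (ZMod 2) (Fin n → ZMod 2)} {u : Fin n → Bool} :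
    u ∈ boolCode A ↔ zmodWord u ∈ A := by
  simp [boolCode]

/-- `boolWord v ∈ boolCode A ↔ v ∈ A`. [cite: MacWilliamsSloane1977, Ch. 1 §2] -/
@[simp] theorem boolWord_mem_boolCode {A : Submodule (ZMod 2) (Fin n → ZMod 2)} {v : Fin n → ZMod 2} :
    boolWord v ∈ boolCode A ↔ v ∈ A := by
  rw [mem_boolCode, zmodWord_boolWord]

/-- The image of a submodule is a binary linear code in the sense of `MacWilliamsIdentity.lean` (nonempty, closed under
coordinatewise XOR). [cite: MacWilliamsSloane1977, Ch. 1 §2; Ch. 5 §2 Thm. 1 hypothesis] -/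
theorem isLinearCode_boolCode (A : Submodule (ZMod 2) (Fin n → ZMod 2)) : IsLinearCode (boolCode A) := by
  refine ⟨⟨fun _ => false, by rw [mem_boolCode, zmodWord_false]; exact A.zero_mem⟩, fun u hu v hv => ?_⟩
  rw [mem_boolCode] at hu hv ⊢
  rw [zmodWord_bne]
  exact A.add_mem hu hv

/-- **The dual codes agree**: `(boolCode A)⊥ = boolCode (A⊥)` (`perpCode` of `MacWilliamsIdentity.lean` versus
`dualCode` of `DualDistance.lean`). [cite: MacWilliamsSloane1977, Ch. 1 §8 eq. (42)] -/
theorem perpCode_boolCode (A : Submodule (ZMod 2) (Fin n → ZMod 2)) : perpCode (boolCode A) = boolCode (dualCode A) := by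
  ext w
  rw [mem_perpCode, mem_boolCode, mem_dualCode_iff]
  constructor
  · intro h c hc
    have h' := h (boolWord c) (boolWord_mem_boolCode.2 hc)
    rw [← boolWord_zmodWord w, dotSign_boolWord_eq_one_iff] at h'
    exact h'
  · intro h u hu
    rw [mem_boolCode] at hu
    have h' := h _ hu
    rw [← dotSign_boolWord_eq_one_iff, boolWord_zmodWord, boolWord_zmodWord] at h'
    exact h'

open scoped Classical in
/-- **Cardinality**: `|boolCode A| = 2^{dim A}`. [cite: MacWilliamsSloane1977, Ch. 1 §2 ("an [n,k] code has 2^k codewords")] -/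
theorem card_boolCode (A : Submodule (ZMod 2) (Fin n → ZMod 2)) :
    #(boolCode A) = 2 ^ Module.finrank (ZMod 2) A := by
  have h1 : #(boolCode A) = #(univ.filter fun v : Fin n → ZMod 2 => v ∈ A) := by
    refine Finset.card_bij (fun u _ => zmodWord u) (fun u hu => ?_) (fun u _ v _ h => zmodWord_injective h)
      (fun v hv => ⟨boolWord v, ?_, zmodWord_boolWord v⟩)
    · rw [mem_boolCode] at hu; simpa using hu
    · rw [mem_filter] at hv; exact boolWord_mem_boolCode.2 hv.2
  rw [h1, ← Fintype.card_subtype, Module.card_eq_pow_finrank (K := ZMod 2) (V := A), ZMod.card]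

/-! ### Weight distributions -/

open scoped Classical in
/-- **The weight distribution** `A_i = #{v ∈ A : wt v = i}` of a binary linear code given as a submodule.
Plumbing definition (bridge to `weightCount`). [cite: MacWilliamsSloane1977, Ch. 5 §2 eq. (1) ("A_i = number of codewords of weight i")] -/
noncomputable def wdist (A : Submodule (ZMod 2) (Fin n → ZMod 2)) (i : ℕ) : ℕ :=
  #(univ.filter fun v : Fin n → ZMod 2 => v ∈ A ∧ hammingNorm v = i)

open scoped Classical in
/-- `weightCount (boolCode A) i = wdist A i`. [cite: MacWilliamsSloane1977, Ch. 5 §2 eq. (1)] -/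
theorem weightCount_boolCode (A : Submodule (ZMod 2) (Fin n → ZMod 2)) (i : ℕ) :
    weightCount (boolCode A) i = wdist A i := by
  unfold weightCount wdist
  refine Finset.card_bij (fun u _ => zmodWord u) (fun u hu => ?_) (fun u _ v _ h => zmodWord_injective h)
    (fun v hv => ⟨boolWord v, ?_, zmodWord_boolWord v⟩)
  · rw [mem_filter, mem_boolCode] at hu
    rw [mem_filter]
    refine ⟨mem_univ _, hu.1, ?_⟩
    rw [← hu.2, ← wt_boolWord, boolWord_zmodWord]
  · rw [mem_filter] at hv ⊢
    exact ⟨boolWord_mem_boolCode.2 hv.2.1, by rw [wt_boolWord]; exact hv.2.2⟩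

open scoped Classical in
/-- `A_0 = 1` (only the zero word has weight `0`). [cite: MacWilliamsSloane1977, Ch. 5 §2 (A_0 = 1)] -/
theorem wdist_zero (A : Submodule (ZMod 2) (Fin n → ZMod 2)) : wdist A 0 = 1 := by
  rw [wdist, Finset.card_eq_one]
  refine ⟨0, ?_⟩
  ext v
  simp only [mem_filter, mem_univ, true_and, mem_singleton, hammingNorm_eq_zero]
  exact ⟨fun h => h.2, fun h => ⟨h ▸ A.zero_mem, h⟩⟩

open scoped Classical in
/-- `Σ_{i=0}^{n} A_i = |A| = 2^{dim A}` (every word has weight `≤ n`). [cite: MacWilliamsSloane1977, Ch. 5 §2 Thm. 1 (put x = y = 1)] -/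
theorem sum_wdist (A : Submodule (ZMod 2) (Fin n → ZMod 2)) :
    ∑ i ∈ range (n + 1), wdist A i = 2 ^ Module.finrank (ZMod 2) A := by
  rw [← card_boolCode]
  have h := sum_eq_sum_weightCount (boolCode A) (fun _ => (1 : ℕ))
  simp only [Finset.sum_const, smul_eq_mul, mul_one] at h
  rw [h]
  exact Finset.sum_congr rfl fun i _ => (weightCount_boolCode A i).symm

open scoped Classical in
/-- A subcode has at most as many words of each weight: `A ≤ B → A_i ≤ B_i`. [cite: MacWilliamsSloane1977, Ch. 5 §2 eq. (1)] -/
theorem wdist_mono {A B : Submodule (ZMod 2) (Fin n → ZMod 2)} (h : A ≤ B) (i : ℕ) : wdist A i ≤ wdist B i := by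
  unfold wdist
  refine Finset.card_le_card fun v hv => ?_
  rw [mem_filter] at hv ⊢
  exact ⟨hv.1, h hv.2.1, hv.2.2⟩

open scoped Classical in
/-- If `A ≤ B` and every word of `B` of weight `i` lies in `A`, then `A_i = B_i`. [cite: MacWilliamsSloane1977, Ch. 5 §2 eq. (1)] -/
theorem wdist_eq_of_forall_mem {A B : Submodule (ZMod 2) (Fin n → ZMod 2)} (h : A ≤ B) {i : ℕ}
    (hi : ∀ v ∈ B, hammingNorm v = i → v ∈ A) : wdist A i = wdist B i := by
  unfold wdist
  congr 1
  ext v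
  simp only [mem_filter, mem_univ, true_and]
  exact ⟨fun hv => ⟨h hv.1, hv.2⟩, fun hv => ⟨hi v hv.1 hv.2, hv.2⟩⟩

open scoped Classical in
/-- If no word of `A` has weight `i`, then `A_i = 0`. [cite: MacWilliamsSloane1977, Ch. 5 §2 eq. (1)] -/
theorem wdist_eq_zero_of_forall {A : Submodule (ZMod 2) (Fin n → ZMod 2)} {i : ℕ}
    (hi : ∀ v ∈ A, hammingNorm v ≠ i) : wdist A i = 0 := by
  rw [wdist, Finset.card_eq_zero, Finset.filter_eq_empty_iff]
  exact fun v _ hv => hi v hv.1 hv.2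

/-! ### The MacWilliams identity in Krawtchouk form for submodules -/

/-- **MacWilliams identity, Krawtchouk form, for `𝔽₂`-submodules**: `2^{dim A} · A'_j = Σ_{i=0}^{n} A_i K_j(i)` where
`A'` is the weight distribution of the dual code `A⊥` (`dualCode A`) and `K_j` the binary Krawtchouk polynomial of
`DelsarteLPBound.lean`. Transported from `card_mul_weightCount_perpCode_eq`. [cite: MacWilliamsSloane1977, Ch. 5 §2 eq. (13) and Thm. 1] -/
theorem pow_finrank_mul_wdist_dualCode (A : Submodule (ZMod 2) (Fin n → ZMod 2)) (j : ℕ) :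
    (2 : ℤ) ^ Module.finrank (ZMod 2) A * wdist (dualCode A) j =
      ∑ i ∈ range (n + 1), (wdist A i : ℤ) * krawtchouk n j i := by
  have h := card_mul_weightCount_perpCode_eq (isLinearCode_boolCode A) j
  rw [card_boolCode, perpCode_boolCode, weightCount_boolCode] at h
  push_cast at h
  rw [h]
  exact Finset.sum_congr rfl fun i _ => by rw [weightCount_boolCode]

end Literature.InformationTheory.Coding
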